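import Summits.Ventures.PercRepro.C041CycleCount3
import Summits.Ventures.PercRepro.C041ThreeExitMain
import Summits.Ventures.PercRepro.C041SquareArcModel

/-!
# ROW C-041 — THE THREE-EXIT CYCLE DICTIONARY: the six-vector of the cycle with three hanging zones IS mine-3's
arc-type model `thetaSq` (p6, gen 31; C-041.md §21 (ah) «the dictionary thetaSq = the cycle's six-vector», paper-level
until now)

The cycle `cyc n` through the anchor `0` with the zones `Z`, `Z'`, `Z''` at `x_i`, `x_j`, `x_k` (`0 < i < j < k`) is
the three-exit attachment `cyc3`; by THEOREM (THREE-EXIT BLOCK MAP) its six-vector is the sum over the `2^{n+1}`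
colourings of `contrib3` of the statuses, the statuses are read off the four arcs (`C041CycleStatus3`), and at a
quadruple of arc types `contrib3` IS mine-3's 81-case table `sqCol` (`contrib3_arc`, one tactic block).  Grouping
the colourings by their arc types and counting them (`card_code_eq4`) gives

* **`sixVec_cyc3`** — `Π(cyc3 n i j k Z a Z' a' Z'' a'') = thetaSq (2^ℓ₁ − 2) (2^ℓ₂ − 2) (2^ℓ₃ − 2) (2^ℓ₄ − 2)
  (Π Z) (Π Z') (Π Z'')` with `ℓ₁ = i`, `ℓ₂ = j − i`, `ℓ₃ = k − j`, `ℓ₄ = n + 1 − k` — every cycle length, every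
  triple of exit positions, any three zones.

Hence mine-3's `InCone_thetaSq_marks_lengths` / `K4v_thetaSq_marks_lengths` (EVERY THREE-EXIT CYCLE WITH THREE
MARKED VERTICES IS IN THE CONE) hold for the cycle zones of the graph model (`C041CycleZone3`).
-/

namespace PercRepro

namespace ZoneZ

namespace TwoExit

open ZoneData Pendant TreeClosure RelaxedTriangle Finset

/-! ## The 81 cases -/

/-- The 27 cases with a blue first arc. -/
theorem contrib3_arc_b (w w' w'' : Vec6) (t₂ t₃ t₄ : Fin 3) :
    contrib3 w w' w'' ((0 : Fin 3) = 0 ∨ (t₂ = 0 ∧ t₃ = 0 ∧ t₄ = 0))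
      ((0 : Fin 3) = 1 ∨ (t₂ = 1 ∧ t₃ = 1 ∧ t₄ = 1))
      (((0 : Fin 3) = 0 ∧ t₂ = 0) ∨ (t₃ = 0 ∧ t₄ = 0)) (((0 : Fin 3) = 1 ∧ t₂ = 1) ∨ (t₃ = 1 ∧ t₄ = 1))
      (t₄ = 0 ∨ ((0 : Fin 3) = 0 ∧ t₂ = 0 ∧ t₃ = 0)) (t₄ = 1 ∨ ((0 : Fin 3) = 1 ∧ t₂ = 1 ∧ t₃ = 1))
      (t₂ = 0 ∨ ((0 : Fin 3) = 0 ∧ t₃ = 0 ∧ t₄ = 0)) (t₃ = 0 ∨ ((0 : Fin 3) = 0 ∧ t₂ = 0 ∧ t₄ = 0))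
      ((t₂ = 0 ∧ t₃ = 0) ∨ ((0 : Fin 3) = 0 ∧ t₄ = 0)) =
      sqCol w w' w'' (arcOf 0) (arcOf t₂) (arcOf t₃) (arcOf t₄) := by
  fin_cases t₂ <;> fin_cases t₃ <;> fin_cases t₄ <;>
    simp only [contrib3, exitOf, sqCol, arcOf, Fin.isValue, Fin.zero_eta, Fin.mk_one, Fin.reduceFinMk,
      Fin.reduceEq, one_ne_zero, zero_ne_one, or_true, or_false, and_self, and_true, and_false, ite_true,
      ite_false] <;>
    first
      | rfl
      | (funext i; fin_cases i <;>
          simp [thR, thB, nAdm, kInv] <;> first | ring1 | exact Or.inl (by ring1))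

/-- The 27 cases with a red first arc. -/
theorem contrib3_arc_r (w w' w'' : Vec6) (t₂ t₃ t₄ : Fin 3) :
    contrib3 w w' w'' ((1 : Fin 3) = 0 ∨ (t₂ = 0 ∧ t₃ = 0 ∧ t₄ = 0))
      ((1 : Fin 3) = 1 ∨ (t₂ = 1 ∧ t₃ = 1 ∧ t₄ = 1))
      (((1 : Fin 3) = 0 ∧ t₂ = 0) ∨ (t₃ = 0 ∧ t₄ = 0)) (((1 : Fin 3) = 1 ∧ t₂ = 1) ∨ (t₃ = 1 ∧ t₄ = 1))
      (t₄ = 0 ∨ ((1 : Fin 3) = 0 ∧ t₂ = 0 ∧ t₃ = 0)) (t₄ = 1 ∨ ((1 : Fin 3) = 1 ∧ t₂ = 1 ∧ t₃ = 1))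
      (t₂ = 0 ∨ ((1 : Fin 3) = 0 ∧ t₃ = 0 ∧ t₄ = 0)) (t₃ = 0 ∨ ((1 : Fin 3) = 0 ∧ t₂ = 0 ∧ t₄ = 0))
      ((t₂ = 0 ∧ t₃ = 0) ∨ ((1 : Fin 3) = 0 ∧ t₄ = 0)) =
      sqCol w w' w'' (arcOf 1) (arcOf t₂) (arcOf t₃) (arcOf t₄) := by
  fin_cases t₂ <;> fin_cases t₃ <;> fin_cases t₄ <;>
    simp only [contrib3, exitOf, sqCol, arcOf, Fin.isValue, Fin.zero_eta, Fin.mk_one, Fin.reduceFinMk,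
      Fin.reduceEq, one_ne_zero, zero_ne_one, or_true, or_false, and_self, and_true, and_false, ite_true,
      ite_false] <;>
    first
      | rfl
      | (funext i; fin_cases i <;>
          simp [thR, thB, nAdm, kInv, jointVec, jv2, RelaxedTriangle.lo, RelaxedTriangle.hi] <;>
          first | ring1 | exact Or.inl (by ring1))

/-- The 27 cases with a mixed first arc. -/
theorem contrib3_arc_x (w w' w'' : Vec6) (t₂ t₃ t₄ : Fin 3) :
    contrib3 w w' w'' ((2 : Fin 3) = 0 ∨ (t₂ = 0 ∧ t₃ = 0 ∧ t₄ = 0))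
      ((2 : Fin 3) = 1 ∨ (t₂ = 1 ∧ t₃ = 1 ∧ t₄ = 1))
      (((2 : Fin 3) = 0 ∧ t₂ = 0) ∨ (t₃ = 0 ∧ t₄ = 0)) (((2 : Fin 3) = 1 ∧ t₂ = 1) ∨ (t₃ = 1 ∧ t₄ = 1))
      (t₄ = 0 ∨ ((2 : Fin 3) = 0 ∧ t₂ = 0 ∧ t₃ = 0)) (t₄ = 1 ∨ ((2 : Fin 3) = 1 ∧ t₂ = 1 ∧ t₃ = 1))
      (t₂ = 0 ∨ ((2 : Fin 3) = 0 ∧ t₃ = 0 ∧ t₄ = 0)) (t₃ = 0 ∨ ((2 : Fin 3) = 0 ∧ t₂ = 0 ∧ t₄ = 0))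
      ((t₂ = 0 ∧ t₃ = 0) ∨ ((2 : Fin 3) = 0 ∧ t₄ = 0)) =
      sqCol w w' w'' (arcOf 2) (arcOf t₂) (arcOf t₃) (arcOf t₄) := by
  fin_cases t₂ <;> fin_cases t₃ <;> fin_cases t₄ <;>
    simp only [contrib3, exitOf, sqCol, arcOf, Fin.isValue, Fin.zero_eta, Fin.mk_one, Fin.reduceFinMk,
      Fin.reduceEq, one_ne_zero, zero_ne_one, or_true, or_false, and_self, and_true, and_false, ite_true,
      ite_false] <;>
    first
      | rfl
      | (funext i; fin_cases i <;>
          simp [thR, thB, nAdm, kInv, jointVec, jv2, RelaxedTriangle.lo, RelaxedTriangle.hi] <;>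
          first | ring1 | exact Or.inl (by ring1))

/-- **The contribution of the statuses of an arc-type quadruple is mine-3's `sqCol`** — the statuses of the
three exits `x_i`, `x_j`, `x_k` by the types of the arcs `[0, i)`, `[i, j)`, `[j, k)`, `[k, n]`. -/
theorem contrib3_arc (w w' w'' : Vec6) (t₁ t₂ t₃ t₄ : Fin 3) :
    contrib3 w w' w'' (t₁ = 0 ∨ (t₂ = 0 ∧ t₃ = 0 ∧ t₄ = 0)) (t₁ = 1 ∨ (t₂ = 1 ∧ t₃ = 1 ∧ t₄ = 1))
      ((t₁ = 0 ∧ t₂ = 0) ∨ (t₃ = 0 ∧ t₄ = 0)) ((t₁ = 1 ∧ t₂ = 1) ∨ (t₃ = 1 ∧ t₄ = 1))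
      (t₄ = 0 ∨ (t₁ = 0 ∧ t₂ = 0 ∧ t₃ = 0)) (t₄ = 1 ∨ (t₁ = 1 ∧ t₂ = 1 ∧ t₃ = 1))
      (t₂ = 0 ∨ (t₁ = 0 ∧ t₃ = 0 ∧ t₄ = 0)) (t₃ = 0 ∨ (t₁ = 0 ∧ t₂ = 0 ∧ t₄ = 0))
      ((t₂ = 0 ∧ t₃ = 0) ∨ (t₁ = 0 ∧ t₄ = 0)) =
      sqCol w w' w'' (arcOf t₁) (arcOf t₂) (arcOf t₃) (arcOf t₄) := by
  fin_cases t₁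
  · exact contrib3_arc_b w w' w'' t₂ t₃ t₄
  · exact contrib3_arc_r w w' w'' t₂ t₃ t₄
  · exact contrib3_arc_x w w' w'' t₂ t₃ t₄

/-! ## The statuses of the cycle with three exits, through the codes -/

variable (n : ℕ) (i j k : Fin (n + 1)) (ω : Fin (n + 1) → Bool)

/-- `x_k`, `x_j` blue-connected (the order of `contrib3`). -/
theorem Mg_cyc3_exits₃₂ (hij : i.val ≤ j.val) (hjk : j.val ≤ k.val) :
    (cyc n).Mg k j ω ↔ allc n (arc₃' n j k) false ω ∨
      (allc n (arc₁ n i) false ω ∧ allc n (arc₂ n i j) false ω ∧ allc n (arc₄ n k) false ω) :=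
  ⟨fun h => (Mg_cyc3_exits₂₃ n i j k ω hij hjk).1 (Mg_symm (cyc n) ω k j h),
    fun h => Mg_symm (cyc n) ω j k ((Mg_cyc3_exits₂₃ n i j k ω hij hjk).2 h)⟩

/-- `x_k`, `x_i` blue-connected (the order of `contrib3`). -/
theorem Mg_cyc3_exits₃₁ (hij : i.val ≤ j.val) (hjk : j.val ≤ k.val) :
    (cyc n).Mg k i ω ↔ (allc n (arc₂ n i j) false ω ∧ allc n (arc₃' n j k) false ω) ∨
      (allc n (arc₁ n i) false ω ∧ allc n (arc₄ n k) false ω) :=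
  ⟨fun h => (Mg_cyc3_exits₁₃ n i j k ω hij hjk).1 (Mg_symm (cyc n) ω k i h),
    fun h => Mg_symm (cyc n) ω i k ((Mg_cyc3_exits₁₃ n i j k ω hij hjk).2 h)⟩

/-- **The contribution of a colouring of the cycle with three exits is `sqCol` at its four arc types**
(`0 < i < j < k`). -/
theorem contrib3_cyc (hi : 0 < i.val) (hij : i.val < j.val) (hjk : j.val < k.val) (w w' w'' : Vec6) :
    contrib3 w w' w'' ((cyc n).Mg 0 i ω) ((cyc n).Rd 0 i ω) ((cyc n).Mg 0 j ω) ((cyc n).Rd 0 j ω)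
        ((cyc n).Mg 0 k ω) ((cyc n).Rd 0 k ω) ((cyc n).Mg i j ω) ((cyc n).Mg k j ω) ((cyc n).Mg k i ω) =
      sqCol w w' w'' (arcOf (code n (arc₁ n i) ω)) (arcOf (code n (arc₂ n i j) ω))
        (arcOf (code n (arc₃' n j k) ω)) (arcOf (code n (arc₄ n k) ω)) := by
  have h₁ : ∃ x, arc₁ n i x := ⟨0, by unfold arc₁; simp only [Fin.val_zero]; exact hi⟩
  have h₂ : ∃ x, arc₂ n i j x := ⟨i, by unfold arc₂; exact ⟨le_rfl, hij⟩⟩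
  have h₃ : ∃ x, arc₃' n j k x := ⟨j, by unfold arc₃'; exact ⟨le_rfl, hjk⟩⟩
  have h₄ : ∃ x, arc₄ n k x := ⟨k, by unfold arc₄; exact le_rfl⟩
  rw [← contrib3_arc w w' w'' (code n (arc₁ n i) ω) (code n (arc₂ n i j) ω) (code n (arc₃' n j k) ω)
    (code n (arc₄ n k) ω)]
  simp only [code_eq_zero_iff, code_eq_one_iff n h₁, code_eq_one_iff n h₂, code_eq_one_iff n h₃,
    code_eq_one_iff n h₄]
  rw [Mg_cyc3_exit₁ n i j k ω hij.le hjk.le, Rd_cyc3_exit₁ n i j k ω hij.le hjk.le,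
    Mg_cyc3_exit₂ n i j k ω hij.le hjk.le, Rd_cyc3_exit₂ n i j k ω hij.le hjk.le,
    Mg_cyc3_exit₃ n i j k ω hij.le hjk.le, Rd_cyc3_exit₃ n i j k ω hij.le hjk.le,
    Mg_cyc3_exits₁₂ n i j k ω hij.le hjk.le, Mg_cyc3_exits₃₂ n i j k ω hij.le hjk.le,
    Mg_cyc3_exits₃₁ n i j k ω hij.le hjk.le]

/-! ## THE THREE-EXIT CYCLE DICTIONARY -/

variable {V E T₁ T₂ V' E' T₁' T₂' V'' E'' T₁'' T₂'' : Type} (Z : ZoneData V E T₁ T₂) (a : V)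
  (Z' : ZoneData V' E' T₁' T₂') (a' : V') (Z'' : ZoneData V'' E'' T₁'' T₂'') (a'' : V'')

/-- THE CYCLE ZONE WITH THREE EXITS: the cycle `C_{n+1}` through the anchor `0` with `Z` at `x_i`, `Z'` at `x_j`
and `Z''` at `x_k`. -/
noncomputable abbrev cyc3 :
    ZoneData (((Fin (n + 1) ⊕ V') ⊕ V) ⊕ V'') (((Fin (n + 1) ⊕ E') ⊕ E) ⊕ E'') ((T₁' ⊕ T₁) ⊕ T₁'')
      ((T₂' ⊕ T₂) ⊕ T₂'') :=
  glue3 (cyc n) i j k Z a Z' a' Z'' a''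

section Six

variable [Fintype E] [DecidableEq E] [Fintype T₁] [DecidableEq T₁] [Fintype T₂] [DecidableEq T₂] [Fintype E']
  [DecidableEq E'] [Fintype T₁'] [DecidableEq T₁'] [Fintype T₂'] [DecidableEq T₂'] [Fintype E''] [DecidableEq E'']
  [Fintype T₁''] [DecidableEq T₁''] [Fintype T₂''] [DecidableEq T₂'']

/-- **THE THREE-EXIT CYCLE DICTIONARY**: the six-vector of the cycle `C_{n+1}` with `Z`, `Z'`, `Z''` at `x_i`,
`x_j`, `x_k` (`0 < i < j < k`) is mine-3's three-exit arc-type model with the multiplicities `2^ℓ − 2` of the arcs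
`[0, i)`, `[i, j)`, `[j, k)`, `[k, n]`. -/
theorem sixVec_cyc3 (hi : 0 < i.val) (hij : i.val < j.val) (hjk : j.val < k.val) :
    (cyc3 n i j k Z a Z' a' Z'' a'').sixVec (Sum.inl (Sum.inl (Sum.inl 0))) =
      thetaSq ((2 : ℝ) ^ i.val - 2) ((2 : ℝ) ^ (j.val - i.val) - 2) ((2 : ℝ) ^ (k.val - j.val) - 2)
        ((2 : ℝ) ^ (n + 1 - k.val) - 2) (Z.sixVec a) (Z'.sixVec a') (Z''.sixVec a'') := by
  classical
  rw [sixVec_glue3]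
  have e1 : ∀ ω : Fin (n + 1) → Bool,
      contrib3 (Z.sixVec a) (Z'.sixVec a') (Z''.sixVec a'') ((cyc n).Mg 0 i ω) ((cyc n).Rd 0 i ω)
        ((cyc n).Mg 0 j ω) ((cyc n).Rd 0 j ω) ((cyc n).Mg 0 k ω) ((cyc n).Rd 0 k ω) ((cyc n).Mg i j ω)
        ((cyc n).Mg k j ω) ((cyc n).Mg k i ω) =
      sqCol (Z.sixVec a) (Z'.sixVec a') (Z''.sixVec a'') (arcOf (code n (arc₁ n i) ω))
        (arcOf (code n (arc₂ n i j) ω)) (arcOf (code n (arc₃' n j k) ω)) (arcOf (code n (arc₄ n k) ω)) :=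
    fun ω => contrib3_cyc n i j k ω hi hij hjk _ _ _
  simp only [e1]
  rw [← Finset.sum_fiberwise (univ : Finset (Fin (n + 1) → Bool))
    (fun ω => (code n (arc₁ n i) ω, code n (arc₂ n i j) ω, code n (arc₃' n j k) ω, code n (arc₄ n k) ω))]
  have e2 : ∀ t : Fin 3 × Fin 3 × Fin 3 × Fin 3,
      (∑ ω ∈ (univ : Finset (Fin (n + 1) → Bool)).filter
          (fun ω => (code n (arc₁ n i) ω, code n (arc₂ n i j) ω, code n (arc₃' n j k) ω,
            code n (arc₄ n k) ω) = t),
        sqCol (Z.sixVec a) (Z'.sixVec a') (Z''.sixVec a'') (arcOf (code n (arc₁ n i) ω))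
          (arcOf (code n (arc₂ n i j) ω)) (arcOf (code n (arc₃' n j k) ω)) (arcOf (code n (arc₄ n k) ω))) =
      ((multN t.1 i.val * (multN t.2.1 (j.val - i.val) * (multN t.2.2.1 (k.val - j.val) *
          multN t.2.2.2 (n + 1 - k.val))) : ℕ) : ℝ) •
        sqCol (Z.sixVec a) (Z'.sixVec a') (Z''.sixVec a'') (arcOf t.1) (arcOf t.2.1) (arcOf t.2.2.1)
          (arcOf t.2.2.2) := by
    rintro ⟨t₁, t₂, t₃, t₄⟩
    rw [Finset.sum_congr rfl (g := fun _ => sqCol (Z.sixVec a) (Z'.sixVec a') (Z''.sixVec a'') (arcOf t₁)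
      (arcOf t₂) (arcOf t₃) (arcOf t₄))
      (fun ω hω => by
        rw [Finset.mem_filter, Prod.mk.injEq, Prod.mk.injEq, Prod.mk.injEq] at hω
        rw [hω.2.1, hω.2.2.1, hω.2.2.2.1, hω.2.2.2.2]),
      Finset.sum_const, card_code_eq4 n i j k hi hij hjk, Nat.cast_smul_eq_nsmul]
  simp only [e2]
  have hℓ₁ : 1 ≤ i.val := hi
  have hℓ₂ : 1 ≤ j.val - i.val := by omega
  have hℓ₃ : 1 ≤ k.val - j.val := by omega
  have hℓ₄ : 1 ≤ n + 1 - k.val := by have := k.is_le; omega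
  rw [Fintype.sum_prod_type]
  simp only [Fintype.sum_prod_type, Fin.sum_univ_three, Nat.cast_mul, multN_cast _ hℓ₁, multN_cast _ hℓ₂,
    multN_cast _ hℓ₃, multN_cast _ hℓ₄]
  unfold thetaSq sqTerm
  simp only [arcOf, mul_assoc]
  abel

end Six

end TwoExit

end ZoneZ

end PercRepro
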